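import Literature.AlgebraicTopology.Homotopy.MappingTelescopeSlide
import HarnessLib

/-!
# The telescope of an idempotent `e = j ∘ r` through `Y` is homotopy equivalent to `Y`

Topic `Literature/AlgebraicTopology/Homotopy` (sub-namespace `Telescope`), continuing
`MappingTelescope.lean` / `MappingTelescopeSlide.lean`. The key step of Hatcher's proof of
Prop. A.11 (*Algebraic Topology* (2002), p. 528): if `Y →ʲ X →ʳ Y` with `r j = 𝟙` (here:
strictly; `X = P` a compact subset of a normed space containing `j(Y)`, `r` continuous on `P`),
then the mapping telescope of the idempotent `e = j r : P → P` is homotopy equivalent to `Y`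
(Hatcher: `T(ir, ir, …) ≃ T(r, i, r, i, …) ≃ T(ri, ri, …) ≃ Y × [0, ∞) ≃ Y`; we give the direct
maps: `τ (x, k + s) = r x`, `σ y = (j y, 0)`, `τ σ = 𝟙`, and `σ τ ≃ shift ≃ 𝟙`, the first
homotopy sliding `(j r x, 0)` up to `(e x, k + 1 + s) = shift (x, k + s)` along the section of the
telescope over `j(Y)`, on which `e` is the identity).

* `Telescope.RetractionData P Y`: the data `j`, `r` with `r ∘ j = id`, `j(Y) ⊆ P`;
* `Telescope.RetractionData.homotopyEquiv : ↥(space e P) ≃ₕ Y`.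

No `sorry`; proofs are explicit homotopies ([folklore] packaging of Hatcher's argument).

## References

* A. Hatcher, *Algebraic Topology*, CUP (2002), Appendix, proof of Prop. A.11 (p. 528).
  [HatcherAT2002]
-/

noncomputable section

open Set Function Topology Filter unitInterval

namespace Literature.AlgebraicTopology.Homotopy

namespace Telescope

variable {E : Type*} [NormedAddCommGroup E] {P : Set E} {Y : Type*} [TopologicalSpace Y]

/-! ### Retraction data -/

variable (P Y) in
/-- **Retraction data**: a space `Y`, a map `j : Y → E` into `P` and a map `r : E → Y`
continuous on `P` with `r (j y) = y` (so `j` embeds `Y` as a retract of `P`; Hatcher 2002,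
p. 528: `Y →ⁱ X →ʳ Y`, `ri = 𝟙`). [cite: HatcherAT2002, Appendix p. 528 (domination)] -/
structure RetractionData where
  /-- the inclusion of `Y` -/
  j : Y → E
  /-- the retraction onto `Y` -/
  r : E → Y
  continuous_j : Continuous j
  continuousOn_r : ContinuousOn r P
  j_mem : ∀ y, j y ∈ P
  r_j : ∀ y, r (j y) = y

namespace RetractionData

variable (R : RetractionData P Y)

/-- The idempotent `e = j ∘ r : E → E` of the retraction data. [folklore] -/
def e : E → E := fun x => R.j (R.r x)

/-- Unfolding `e`. [folklore] -/
theorem e_apply (x : E) : R.e x = R.j (R.r x) := rfl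

/-- `e` takes values in `P`. [folklore] -/
theorem e_mem (x : E) : R.e x ∈ P := R.j_mem _

/-- `e` maps `P` into `P`. [folklore] -/
theorem mapsTo_e : MapsTo R.e P P := fun x _ => R.e_mem x

/-- `e` is continuous on `P`. [folklore] -/
theorem continuousOn_e : ContinuousOn R.e P := R.continuous_j.comp_continuousOn R.continuousOn_r

/-- `e` is idempotent. [folklore] -/
@[simp]
theorem e_e (x : E) : R.e (R.e x) = R.e x := by
  simp [e, R.r_j]

/-- `r e = r`. [folklore] -/
@[simp]
theorem r_e (x : E) : R.r (R.e x) = R.r x := by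
  simp [e, R.r_j]

/-- `e` fixes `j(Y)`. [folklore] -/
@[simp]
theorem e_j (y : Y) : R.e (R.j y) = R.j y := by
  simp [e, R.r_j]

section Tel

variable [NormedSpace ℝ E]

/-! ### The maps `τ : T(e) → Y` and `σ : Y → T(e)` -/

/-- `τ (x, k + s) = r x`, as a function on the ambient space. [folklore] -/
def tauFun : E × E × ℝ → Y := lift fun _ x _ => R.r x

/-- `τ` on telescope points. [folklore] -/
theorem tauFun_emb (k : ℕ) {x : E} (hx : x ∈ P) {s : ℝ} (hs : s ∈ Icc (0 : ℝ) 1) :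
    R.tauFun (emb R.e k x s) = R.r x :=
  lift_emb (P := P) (f := R.e) (fun _ x _ => (R.r_e x).symm) k hx hs

/-- `τ` is continuous on the telescope. [folklore] -/
theorem continuousOn_tauFun (hP : IsCompact P) : ContinuousOn R.tauFun (space R.e P) :=
  continuousOn_lift hP R.continuousOn_e (fun _ x _ => (R.r_e x).symm) fun _ =>
    R.continuousOn_r.comp continuousOn_fst fun _ hp => hp.1

/-- `τ : T(e) → Y`. [folklore] -/
def tau (hP : IsCompact P) : C(space R.e P, Y) :=
  ⟨(space R.e P).restrict R.tauFun, (R.continuousOn_tauFun hP).restrict⟩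

/-- `(j y, 0, 0) = emb e 0 (j y) 0`. [folklore] -/
theorem emb_zero_j (y : Y) : emb R.e 0 (R.j y) 0 = ((R.j y, 0, 0) : E × E × ℝ) := by
  simp [emb]

/-- `(j y, 0, 0)` is a telescope point. [folklore] -/
theorem j_mem_space (y : Y) : ((R.j y, 0, 0) : E × E × ℝ) ∈ space R.e P := by
  rw [← R.emb_zero_j y]
  exact emb_mem_space 0 (R.j_mem y) ⟨le_rfl, zero_le_one⟩

/-- `σ y = (j y, 0, 0) = emb e 0 (j y) 0`. [folklore] -/
def sigma : C(Y, space R.e P) :=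
  ⟨fun y => ⟨((R.j y, 0, 0) : E × E × ℝ), R.j_mem_space y⟩,
    (R.continuous_j.prodMk continuous_const).subtype_mk _⟩

/-- `σ y` is the telescope point `emb e 0 (j y) 0`. [folklore] -/
theorem sigma_apply_coe (y : Y) : (R.sigma y : E × E × ℝ) = emb R.e 0 (R.j y) 0 :=
  (R.emb_zero_j y).symm

/-- `τ ∘ σ = 𝟙`. [folklore] -/
theorem tau_comp_sigma (hP : IsCompact P) : (R.tau hP).comp R.sigma = ContinuousMap.id Y := by
  ext y
  show R.tauFun (R.sigma y : E × E × ℝ) = y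
  rw [sigma_apply_coe, R.tauFun_emb 0 (R.j_mem y) ⟨le_rfl, zero_le_one⟩, R.r_j]

/-! ### The section of the telescope over `j(Y)` and the homotopy `σ τ ≃ shift` -/

/-- The section of the telescope over the fixed points of `e`: `γ z a = (z, a)`, i.e.
`emb e ⌊a⌋ z (a - ⌊a⌋)`. [folklore] -/
def gam (z : E) (a : ℝ) : E × E × ℝ := emb R.e ⌊a⌋₊ z (a - ⌊a⌋₊)

/-- The section on `[n, n + 1)`. [folklore] -/
theorem gam_eq_of_mem_Ico {z : E} {a : ℝ} {n : ℕ} (ha : a ∈ Ico (n : ℝ) (n + 1)) :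
    R.gam z a = emb R.e n z (a - n) := by
  have hn : ⌊a⌋₊ = n := by
    rw [Nat.floor_eq_iff (le_trans (Nat.cast_nonneg n) ha.1)]
    exact ⟨ha.1, ha.2⟩
  simp only [gam, hn]

/-- On fixed points of `e`, the section is continuous in `(z, a)`, `a ≥ 0`: on
`K × [n, n + 1]` it is `emb e n z (a - n)`, and these agree at integer heights because
`e z = z`. [folklore] -/
theorem continuousOn_gam (hP : IsCompact P) :
    ContinuousOn (fun q : E × ℝ => R.gam q.1 q.2) ((R.e '' P) ×ˢ Ici 0) := by
  set K := R.e '' P with hK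
  have hKP : K ⊆ P := by
    rintro _ ⟨x, hx, rfl⟩
    exact R.e_mem x
  have hfix : ∀ z ∈ K, R.e z = z := by
    rintro _ ⟨x, hx, rfl⟩
    exact R.e_e x
  -- locally finite closed cover by `K × [n, n + 1]`
  have hcov : K ×ˢ Ici (0 : ℝ) ⊆ ⋃ n : ℕ, K ×ˢ Icc (n : ℝ) (n + 1) := by
    rintro ⟨z, a⟩ ⟨hz, ha⟩
    refine mem_iUnion.2 ⟨⌊a⌋₊, hz, Nat.floor_le ha, (Nat.lt_floor_add_one a).le⟩
  have hlf : LocallyFinite fun n : ℕ => K ×ˢ Icc (n : ℝ) (n + 1) := by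
    have h1 : LocallyFinite fun n : ℕ => Icc (n : ℝ) (n + 1) := by
      intro a
      refine ⟨Ioo (a - 1) (a + 1), Ioo_mem_nhds (by linarith) (by linarith), ?_⟩
      refine (finite_Iio (⌊a⌋₊ + 2)).subset ?_
      rintro n ⟨b, hb, hb'⟩
      have h3 : a < ⌊a⌋₊ + 1 := Nat.lt_floor_add_one _
      show n < ⌊a⌋₊ + 2
      have h4 : (n : ℝ) < ⌊a⌋₊ + 2 := by linarith [hb.1, hb'.2]
      exact_mod_cast h4
    exact h1.prod_left fun _ => K
  refine ContinuousOn.mono ?_ hcov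
  refine hlf.continuousOn_iUnion (fun n => ?_) fun n => ?_
  · exact (hP.image_of_continuousOn R.continuousOn_e).isClosed.prod isClosed_Icc
  · -- on `K × [n, n + 1]`, `gam = emb e n z (a - n)`
    have hc : ContinuousOn (fun q : E × ℝ => emb R.e n q.1 (q.2 - n)) (K ×ˢ Icc (n : ℝ) (n + 1)) :=
      (continuousOn_emb R.continuousOn_e n).comp (continuousOn_fst.prodMk
        (continuousOn_snd.sub continuousOn_const)) fun q hq => ⟨hKP hq.1, mem_univ _⟩
    refine hc.congr ?_
    rintro ⟨z, a⟩ ⟨hz, ha⟩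
    dsimp only at hz ha ⊢
    rcases ha.2.lt_or_eq with h1 | h1
    · exact R.gam_eq_of_mem_Ico ⟨ha.1, h1⟩
    · rw [h1]
      have h2 : R.gam z ((n : ℝ) + 1) = emb R.e (n + 1) z 0 := by
        have := R.gam_eq_of_mem_Ico (z := z) (n := n + 1) (a := (n : ℝ) + 1)
          ⟨by push_cast; exact le_rfl, by push_cast; linarith⟩
        rw [this]
        congr 1
        push_cast
        ring
      rw [h2, add_sub_cancel_left, emb_one, hfix z hz]

/-- The section takes values in the telescope. [folklore] -/
theorem gam_mem {z : E} (hz : z ∈ P) {a : ℝ} (ha : 0 ≤ a) : R.gam z a ∈ space R.e P :=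
  emb_mem_space _ hz ⟨sub_nonneg.2 (Nat.floor_le ha), by linarith [Nat.lt_floor_add_one a]⟩

/-- Levelwise data of the homotopy from `σ τ` to the shift: slide `(e x, 0)` up by
`u (k + 1 + s)`. [folklore] -/
def sigmaTauData (u : ℝ) (k : ℕ) (x : E) (s : ℝ) : E × E × ℝ := R.gam (R.e x) (u * (k + 1 + s))

/-- Compatibility of the homotopy data with the telescope identification. [folklore] -/
theorem sigmaTauData_compat (u : ℝ) (k : ℕ) (x : E) :
    R.sigmaTauData u k x 1 = R.sigmaTauData u (k + 1) (R.e x) 0 := by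
  simp only [sigmaTauData, e_e, Nat.cast_add, Nat.cast_one, add_zero]

/-- The homotopy `σ τ ≃ shift` as a function on the ambient space. [folklore] -/
def sigmaTauFun (q : (E × E × ℝ) × I) : E × E × ℝ := lift (R.sigmaTauData q.2) q.1

/-- The homotopy on telescope points. [folklore] -/
theorem sigmaTauFun_emb (k : ℕ) {x : E} (hx : x ∈ P) {s : ℝ} (hs : s ∈ Icc (0 : ℝ) 1)
    (u : I) : R.sigmaTauFun (emb R.e k x s, u) = R.sigmaTauData u k x s :=
  lift_emb (P := P) (f := R.e) (fun k x _ => R.sigmaTauData_compat u k x) k hx hs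

/-- The homotopy is continuous on `telescope × [0, 1]`. [folklore] -/
theorem continuousOn_sigmaTauFun (hP : IsCompact P) :
    ContinuousOn R.sigmaTauFun (space R.e P ×ˢ univ) := by
  refine continuousOn_prod_of_comp_emb hP R.continuousOn_e fun k => ?_
  have heq : ∀ q ∈ (P ×ˢ Icc (0 : ℝ) 1) ×ˢ (univ : Set I),
      R.sigmaTauFun (emb R.e k q.1.1 q.1.2, q.2) = R.sigmaTauData q.2 k q.1.1 q.1.2 :=
    fun q hq => R.sigmaTauFun_emb k hq.1.1 hq.1.2 q.2
  refine ContinuousOn.congr ?_ heq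
  unfold sigmaTauData
  have h2 : ContinuousOn (fun q : (E × ℝ) × I => (R.e q.1.1, (q.2 : ℝ) * (k + 1 + q.1.2)))
      ((P ×ˢ Icc (0 : ℝ) 1) ×ˢ (univ : Set I)) := by
    refine ContinuousOn.prodMk ?_ ?_
    · exact R.continuousOn_e.comp continuousOn_fst.fst fun q hq => hq.1.1
    · exact (by fun_prop : Continuous fun q : (E × ℝ) × I =>
        (q.2 : ℝ) * (k + 1 + q.1.2)).continuousOn
  refine (R.continuousOn_gam hP).comp h2 ?_
  · rintro ⟨⟨x, s⟩, u⟩ ⟨⟨hx, hs⟩, -⟩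
    refine ⟨mem_image_of_mem _ hx, ?_⟩
    show (0 : ℝ) ≤ u * (k + 1 + s)
    have : (0 : ℝ) ≤ (k : ℝ) + 1 + s := by linarith [hs.1]
    exact mul_nonneg u.2.1 this

/-- The homotopy stays in the telescope. [folklore] -/
theorem sigmaTauFun_mem {p : E × E × ℝ} (hp : p ∈ space R.e P) (u : I) :
    R.sigmaTauFun (p, u) ∈ space R.e P := by
  obtain ⟨k, x, s, hx, hs, rfl⟩ := exists_rep R.mapsTo_e hp
  rw [R.sigmaTauFun_emb k hx (Ico_subset_Icc_self hs) u, sigmaTauData]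
  refine R.gam_mem (R.e_mem x) (mul_nonneg u.2.1 ?_)
  linarith [hs.1]

/-- At time `0` the homotopy is `σ τ`. [folklore] -/
theorem sigmaTauFun_zero (hP : IsCompact P) {p : E × E × ℝ} (hp : p ∈ space R.e P) :
    R.sigmaTauFun (p, 0) = (R.sigma.comp (R.tau hP)) ⟨p, hp⟩ := by
  obtain ⟨k, x, s, hx, hs, rfl⟩ := exists_rep R.mapsTo_e hp
  rw [R.sigmaTauFun_emb k hx (Ico_subset_Icc_self hs) 0, sigmaTauData]
  show R.gam (R.e x) ((0 : ℝ) * _) = (R.sigma (R.tauFun (emb R.e k x s)) : E × E × ℝ)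
  rw [zero_mul, R.tauFun_emb k hx (Ico_subset_Icc_self hs), sigma_apply_coe,
    R.gam_eq_of_mem_Ico (n := 0) ⟨by simp, by simp⟩]
  simp [e]

/-- At time `1` the homotopy is the shift. [folklore] -/
theorem sigmaTauFun_one {p : E × E × ℝ} (hp : p ∈ space R.e P) :
    R.sigmaTauFun (p, 1) = shift R.e p := by
  obtain ⟨k, x, s, hx, hs, rfl⟩ := exists_rep R.mapsTo_e hp
  rw [R.sigmaTauFun_emb k hx (Ico_subset_Icc_self hs) 1, sigmaTauData,
    shift_emb k hx (Ico_subset_Icc_self hs)]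
  show R.gam (R.e x) ((1 : ℝ) * _) = _
  rw [one_mul, R.gam_eq_of_mem_Ico (n := k + 1) ⟨by push_cast; linarith [hs.1],
    by push_cast; linarith [hs.2]⟩]
  congr 1
  push_cast
  ring

/-- **`σ τ` is homotopic to the shift of `T(e)`** (slide `(j r x, 0)` up along the section over
`j(Y)`). [folklore] -/
def sigmaTauHomotopy (hP : IsCompact P) :
    ContinuousMap.Homotopy (R.sigma.comp (R.tau hP)) (shiftMap hP R.continuousOn_e R.mapsTo_e) :=
  homotopyOfAmbient _ _ R.sigmaTauFun (R.continuousOn_sigmaTauFun hP)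
    (fun _ hp u => R.sigmaTauFun_mem hp u) (fun p => R.sigmaTauFun_zero hP p.2)
    fun p => R.sigmaTauFun_one p.2

/-- **The telescope of `e = j r` is homotopy equivalent to `Y`** (Hatcher 2002, proof of
Prop. A.11, p. 528, for the strict retraction `r j = 𝟙`): `τ : T(e) → Y`, `(x, k + s) ↦ r x`,
with homotopy inverse `σ : y ↦ (j y, 0)`; `τ σ = 𝟙` and `σ τ ≃ shift ≃ 𝟙`. [cite: HatcherAT2002, Prop. A.11 (proof)] -/
def homotopyEquiv (hP : IsCompact P) : ContinuousMap.HomotopyEquiv (space R.e P) Y where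
  toFun := R.tau hP
  invFun := R.sigma
  left_inv :=
    ⟨((slideHomotopy hP R.continuousOn_e R.mapsTo_e).trans (R.sigmaTauHomotopy hP).symm).symm⟩
  right_inv := by
    rw [R.tau_comp_sigma hP]

end Tel

end RetractionData

end Telescope

end Literature.AlgebraicTopology.Homotopy

end
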